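import Literature.NumberTheory.EllipticCurves.Gamma1NewformLSeriesProofs
import Literature.NumberTheory.EllipticCurves.Gamma1FrickeFunctionalEquationProofs
import Literature.NumberTheory.EllipticCurves.Gamma1NewformLSeriesFrickeProofs
import Literature.NumberTheory.EllipticCurves.NewformGaloisRepOddProofs
import Literature.NumberTheory.GaloisRepresentations.ArtinRepFrobeniusProofs
import Literature.NumberTheory.Automorphic.DeligneSerreThm46bLeavesProofs
import Literature.NumberTheory.Automorphic.ArtinLFunctionsFunctionalEquation
import HarnessLib

/-!
# Deligne–Serre 1974, Thm. 4.6 (a): the target from the current leaves of its decomposition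
(pure proofs; companion to `Literature.NumberTheory.Automorphic.LanglandsTunnellProofs` and
`Literature.NumberTheory.Automorphic.DeligneSerreThm46Proofs`)

The named fact
`Literature.NumberTheory.Automorphic.ModularForms.DeligneSerre1974.thm46a_artinConductorNat_eq`
(`LanglandsTunnellProofs`; Deligne–Serre, *Formes modulaires de poids 1*, Ann. Sci. ÉNS (4) 7
(1974), Thm. 4.6 (a), p. 514, with Rem. 4.3: the Artin conductor of a finite-image
representation `ρ : Γ_ℚ → GL₂(ℂ)` attached away from `N` to a weight-one newform of level `N` is
`N`) is reduced in `DeligneSerreThm46Proofs` (`thm46a_of`) to the four standard inputs of the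
printed proof (pp. 515–516, steps (i)–(iv)):

1. (i) the weight-one functional equation `Λ_f(1 - s) = a Λ_{f̃}(s)` of a newform
   (`DeligneSerre1974.weightOne_functionalEquation`; Hecke, Li 1975 [12], Miyake 1971 [13]);
2. (ii) Artin's functional equation `Λ(1 - s, ρ) = W Λ(s, ρ^∨)`
   (`artin_functional_equation (K := ℚ)`; Artin [1]);
3. Rem. 4.5: any finite-image `ρ` attached to `f` is odd (`DeligneSerre1974.rem45_isOdd`);
4. 1.8: `|a_p| ≤ 1` for `p ∣ N` (`IsNewform1.cuspCoeff_of_dvd_level`; Li 1975, Ogg 1969).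

Inputs 3 and 4 are now **theorems of the tree**: Rem. 4.5 is `rem45_isOdd_of`
(`NewformGaloisRepOddProofs`: `det ρ = ε` by Lemme 3.2 and `ε(-1) = -1` in weight one) fed with
the unconditional Lemme 3.2 `DeligneSerre1974.lemma32_complex_holds` (`ArtinRepFrobeniusProofs`,
Frobenius' density theorem in place of Chebotarev) — packaged as `DeligneSerre1974.rem45_isOdd_holds`
in the sibling `DeligneSerreThm46bLeavesProofs` — and 1.8 is `IsNewform1.cuspCoeff_of_dvd_level_holds`
(`Gamma1NewformLSeriesProofs`, Atkin–Lehner–Li theory at a prime dividing the level).  This companion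
file records the resulting **two-leaf form** of Thm. 4.6 (a), exactly as
`DeligneSerreThm46bLeavesProofs` does for Thm. 4.6 (b):

* `ModularForms.DeligneSerre1974.thm46a_of_functionalEquations` — **Thm. 4.6 (a) (finite-image
  form, with Rem. 4.3) from (i) and (ii) alone**;
* `artinConductorNat_eq_level_of_functionalEquations` — the named fact
  `artinConductorNat_eq_level` of `LanglandsTunnell` (continuous `ρ`, `ℂ` with its usual topology)
  from (i) and (ii) alone (`artinConductorNat_eq_level_of`, finite image by
  `ArtinRep.finite_range_holds`);
* `ModularForms.DeligneSerre1974.thm46a_of_cuspCoeff_frickeInvolution1_eq`,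
  `artinConductorNat_eq_level_of_cuspCoeff_frickeInvolution1_eq` — the same two conclusions with
  (i) replaced by its arithmetic input alone: for every weight-one newform `f` of level `N` there
  is `c ≠ 0` with `a_n(w_N f) = c ā_n(f)` for all `n` (`w_N f = c f̃`; Li 1975, Rohrlich 1997
  §3.5 "`f|_k W_N = i^{-k} W(f) f̌`"), the analytic half of (i) — Hecke's functional equation on
  `Γ₁(N)` and the Mellin step "on en déduit que `Λ_f(1 - s) = a Λ_{f̃}(s)`" — being proved in
  `Literature.NumberTheory.EllipticCurves.Gamma1FrickeFunctionalEquationProofs`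
  (`DeligneSerre1974.weightOne_functionalEquation_of`).

So the trust base of `thm46a_artinConductorNat_eq` is now exactly the two functional equations
(i), (ii) — and of (i) only the identity `w_N f = c f̃` for `f` primitive: everything
Deligne–Serre-specific (steps (iii)–(iv), Lemme 4.9, the Euler products of `Φ_f` and `L(s, ρ)`,
the conductor of the dual, Rem. 4.4–4.5, 1.8, the Mellin transform) is proved, and the
discharge `thm46a_artinConductorNat_eq_holds` is `thm46a_of_functionalEquations` applied to the
discharges of (i) and (ii) once they land.  (ii) is Artin–Brauer–Hecke (Brauer induction,
Artin reciprocity and Hecke's functional equation for `L`-functions of finite-order Hecke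
characters of number fields).  No definition, no new named fact, nothing restated.

## Update: (i) is discharged — Thm. 4.6 (a) from Artin's functional equation alone

(i) is now a **theorem of the tree**: `DeligneSerre1974.weightOne_functionalEquation_holds`
(`Literature.NumberTheory.EllipticCurves.Gamma1NewformLSeriesFrickeProofs`: the pseudo-eigenvalue
theorem `w_N f = c f̃` for newforms on `Γ₁(N)` by multiplicity one, then Hecke's Mellin transform).
Hence the **one-leaf form**, recorded here exactly as `DeligneSerreThm46bAllPairsProofs` does for
Thm. 4.6 (b):

* `ModularForms.DeligneSerre1974.artinConductorNat_eq_of_pair` — **Thm. 4.6 (a) for one pair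
  `(f, ρ)` from Artin's functional equation of that `ρ` alone**: if `f ∈ S₁(Γ₁(N))` is a newform,
  `ρ : Γ_ℚ → GL₂(ℂ)` is continuous and attached to `f` away from `N`, and `Λ(s, ρ)`, `Λ(s, ρ^∨)`
  satisfy `Λ(1 - s, ρ) = W Λ(s, ρ^∨)` (`ArtinRep.SatisfiesFunctionalEquation ρ ρ^∨`), then
  `𝔣(ρ) = N`.  The proof is that of `thm46a_of` (`DeligneSerreThm46Proofs`, steps (iii)–(iv) with
  Lemme 4.9) run for the single pair, with Rem. 4.5, 1.8 and (i) fed by their discharges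
  (`rem45_isOdd_holds`, `IsNewform1.cuspCoeff_of_dvd_level_holds`,
  `weightOne_functionalEquation_holds`) and the finite image by `finite_range_framed`;
* `ModularForms.DeligneSerre1974.thm46a_of_artin_functional_equation`,
  `artinConductorNat_eq_level_of_artin_functional_equation`,
  `artinConductorNat_eq_level_of_pair` — the named facts `thm46a_artinConductorNat_eq` and
  `artinConductorNat_eq_level` from `artin_functional_equation (K := ℚ)` alone, resp. for one
  pair from the functional equation of that `ρ`;
* `ModularForms.DeligneSerre1974.thm46a_of_brauer_of_rankOne`,
  `artinConductorNat_eq_level_of_brauer_of_rankOne` — the same against the current leaves of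
  (ii) in `Literature.NumberTheory.Automorphic.ArtinLFunctionsFunctionalEquation` (Neukirch VII,
  proof of (12.6): Brauer's factorisation `brauer_completedArtinLFunction_eq_prod_zpow` over `ℚ`
  and the degree-one case `artin_functional_equation_rankOne` over every number field, assembled
  by the proved `artin_functional_equation_of_brauer_of_rankOne`).

So `thm46a_artinConductorNat_eq_holds` is now `thm46a_of_artin_functional_equation` applied to
`artin_functional_equation_holds (K := ℚ)` once (ii) is discharged; pointwise, the conductor of a
given `ρ` attached to `f` is `N` as soon as that `ρ` satisfies Artin's functional equation.

## References

* P. Deligne, J.-P. Serre, *Formes modulaires de poids 1*, Ann. Sci. ÉNS (4) 7 (1974),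
  507–530, doi:10.24033/asens.1277 — Thm. 4.6 (a) (p. 514) and its proof (i)–(iv), Lemme 4.9
  (pp. 515–516), Rem. 4.3, Rem. 4.5 (p. 514), 1.8 (pp. 509–510) (`DeligneSerreASENS1974`).
-/

noncomputable section

open scoped MatrixGroups ModularForm NumberField

open CongruenceSubgroup

/-! ### Thm. 4.6 (a) from the two functional equations -/

namespace Literature.NumberTheory.Automorphic

namespace ModularForms.DeligneSerre1974

open EllipticCurves.ModularForms EllipticCurves.ModularForms.DeligneSerre1974

variable {N : ℕ} [NeZero N]

/-- **Deligne–Serre 1974, Thm. 4.6 (a) (with Rem. 4.3), from the two functional equations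
alone.**  If (i) every weight-one newform of level `N` satisfies the functional equation
`Λ_f(1 - s) = a Λ_{f̃}(s)` (`DeligneSerre1974.weightOne_functionalEquation`, op. cit. p. 515 (i),
after Li [12] and Miyake [13]) and (ii) every framed Artin representation of `Γ_ℚ` satisfies
Artin's functional equation `Λ(1 - s, ρ) = W Λ(s, ρ^∨)` (`artin_functional_equation (K := ℚ)`,
op. cit. (ii), after Artin [1]), then every finite-image `ρ : Γ_ℚ → GL₂(ℂ)` attached away from
`N` to a weight-one newform `f ∈ S₁(Γ₁(N))` has Artin conductor `N`
(`thm46a_artinConductorNat_eq`).  This is `thm46a_of` (`DeligneSerreThm46Proofs`: steps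
(iii)–(iv), Lemme 4.9, the Euler products, the conductor of the dual — all proved) with its
inputs Rem. 4.5 and 1.8 discharged (`rem45_isOdd_of lemma32_complex_holds`, i.e.
`thm46a_of_lemma32` of `NewformGaloisRepOddProofs` at `lemma32_complex_holds`, and
`IsNewform1.cuspCoeff_of_dvd_level_holds`).
[cite: DeligneSerreASENS1974, Thm. 4.6 (a) and its proof, (i)–(iv)] -/
theorem thm46a_of_functionalEquations (hFEf : weightOne_functionalEquation (N := N))
    (hFEρ : artin_functional_equation (K := ℚ)) :
    thm46a_artinConductorNat_eq (N := N) :=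
  thm46a_of_lemma32 GaloisRepresentations.DeligneSerre1974.lemma32_complex_holds hFEf
    IsNewform1.cuspCoeff_of_dvd_level_holds hFEρ

/-- **Deligne–Serre 1974, Thm. 4.6 (a) (with Rem. 4.3), from `w_N f = c f̃` and Artin's
functional equation.**  As `thm46a_of_functionalEquations`, with the weight-one functional
equation (i) replaced by its arithmetic input alone (op. cit. p. 515: "Du fait que `f` est
primitive, il existe une constante `λ ≠ 0` telle que `f(-1/Nz) = λ z f̃(z)`, cf. [12] et [13]"),
in the coefficientwise form `a_n(w_N f) = c ā_n(f)`, `c ≠ 0`, for the Fricke involution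
`frickeInvolution1 N 1` (Rohrlich 1997, §3.5: "`f|_k W_N = i^{-k} W(f) f̌`"); the Mellin step
"on en déduit que `Λ_f(1 - s) = a Λ_{f̃}(s)`" is the theorem
`DeligneSerre1974.weightOne_functionalEquation_of` of
`Literature.NumberTheory.EllipticCurves.Gamma1FrickeFunctionalEquationProofs`.
[cite: DeligneSerreASENS1974, Thm. 4.6 (a) and §4 (b) proof of Thm. 4.6 (i)]
[cite: RohrlichCSS1997, §3.5 Prop. 18] -/
theorem thm46a_of_cuspCoeff_frickeInvolution1_eq
    (hW : ∀ {f : CuspForm (Gamma1 N) 1}, IsNewform1 f → ∃ c : ℂ, c ≠ 0 ∧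
      ∀ n : ℕ, cuspCoeff (frickeInvolution1 N 1 f) n = c * (starRingEnd ℂ) (cuspCoeff f n))
    (hFEρ : artin_functional_equation (K := ℚ)) :
    thm46a_artinConductorNat_eq (N := N) :=
  thm46a_of_functionalEquations (weightOne_functionalEquation_of hW) hFEρ

end ModularForms.DeligneSerre1974

/-! ### The named fact `artinConductorNat_eq_level` from the two functional equations -/

section Lang

open EllipticCurves.ModularForms EllipticCurves.ModularForms.DeligneSerre1974
  ModularForms.DeligneSerre1974

variable {N : ℕ} [NeZero N] {f : CuspForm (Gamma1 N) 1}
  {ρ : GaloisRepresentations.FramedArtinRep ℚ 2}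

/-- **`artinConductorNat_eq_level` from the two functional equations alone**: for a continuous
`ρ : Γ_ℚ → GL₂(ℂ)` (`ℂ` with its usual topology) attached away from `N` to the weight-one newform
`f ∈ S₁(Γ₁(N))`, `𝔣(ρ) = N` (Deligne–Serre 1974, Thm. 4.6 (a) with Rem. 4.3), granted (i)
`DeligneSerre1974.weightOne_functionalEquation` and (ii) `artin_functional_equation (K := ℚ)`;
the finite-image hypothesis of the source is `ArtinRep.finite_range_holds`
(`artinConductorNat_eq_level_of`).  When (i) and (ii) are discharged,
`artinConductorNat_eq_level_holds` is this theorem applied to their `_holds` versions.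
[cite: DeligneSerreASENS1974, Thm. 4.6 (a) and Rem. 4.3] -/
theorem artinConductorNat_eq_level_of_functionalEquations
    (hFEf : weightOne_functionalEquation (N := N)) (hFEρ : artin_functional_equation (K := ℚ)) :
    artinConductorNat_eq_level (f := f) (ρ := ρ) :=
  artinConductorNat_eq_level_of (thm46a_of_functionalEquations hFEf hFEρ)

/-- **`artinConductorNat_eq_level` from `w_N f = c f̃` and Artin's functional equation**: as
`artinConductorNat_eq_level_of_functionalEquations`, with (i) replaced by its arithmetic input
`a_n(w_N f) = c ā_n(f)`, `c ≠ 0`, for every weight-one newform `f` of level `N`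
(`thm46a_of_cuspCoeff_frickeInvolution1_eq` with `artinConductorNat_eq_level_of`).
[cite: DeligneSerreASENS1974, Thm. 4.6 (a) and Rem. 4.3] [cite: RohrlichCSS1997, §3.5 Prop. 18] -/
theorem artinConductorNat_eq_level_of_cuspCoeff_frickeInvolution1_eq
    (hW : ∀ {f : CuspForm (Gamma1 N) 1}, IsNewform1 f → ∃ c : ℂ, c ≠ 0 ∧
      ∀ n : ℕ, cuspCoeff (frickeInvolution1 N 1 f) n = c * (starRingEnd ℂ) (cuspCoeff f n))
    (hFEρ : artin_functional_equation (K := ℚ)) :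
    artinConductorNat_eq_level (f := f) (ρ := ρ) :=
  artinConductorNat_eq_level_of (thm46a_of_cuspCoeff_frickeInvolution1_eq hW hFEρ)

end Lang

/-! ### One pair `(f, ρ)`: Artin's functional equation of that `ρ` suffices -/

namespace ModularForms.DeligneSerre1974

open Filter Topology Complex Field NumberField
open EllipticCurves.ModularForms EllipticCurves.ModularForms.DeligneSerre1974
  GaloisRepresentations.FramedArtinRep

variable {N : ℕ} [NeZero N] {f : CuspForm (Gamma1 N) 1}
  {ρ : GaloisRepresentations.FramedArtinRep ℚ 2}

/-- **Deligne–Serre 1974, Thm. 4.6 (a) for one pair `(f, ρ)`, from Artin's functional equation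
of that `ρ` alone.**  Let `f = Σ a_n qⁿ ∈ S₁(Γ₁(N))` be a newform and `ρ : Γ_ℚ → GL₂(ℂ)` a
continuous representation attached to `f` away from `N` (`IsGaloisRepOfNewform1`: unramified at
`p ∤ N` with `charpoly ρ(Frob_p) = X² - a_p X + ε(p)`) whose completed `L`-functions satisfy
Artin's functional equation `Λ(1 - s, ρ) = W Λ(s, ρ^∨)`, `|W| = 1`
(`ArtinRep.SatisfiesFunctionalEquation ρ ρ^∨`, `ρ^∨ = FramedRep.dual ρ`; op. cit. p. 515 (ii)).
Then the Artin conductor of `ρ` is `N`.  Proof: op. cit. pp. 515–516, steps (iii)–(iv), exactly as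
in `thm46a_of` (`DeligneSerreThm46Proofs`): the Euler products give
`N^{s/2} Λ(s) N_G(s) = 2 M^{s/2} Λ_f(s) D_G(s)` and its `(f̃, ρ^∨)` analogue on `re s > 3/2`
(`artin_mul_prod_eq`, `M = 𝔣(ρ) = 𝔣(ρ^∨)` by `FramedGaloisRep.artinConductorNat_dual`), the two
functional equations turn them into the cross identity (4.9.1)
(`crossIdentity_of_functionalEquations`), and Lemme 4.9 (`lemma49_holds`, through
`level_eq_conductor_of_crossIdentity`) gives `A = (N/M)^{1/2} = 1`.  The other printed inputs are
theorems of the tree: `ρ` has finite image (`finite_range_framed`) and is odd (Rem. 4.5,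
`rem45_isOdd_holds`), `|a_p| ≤ 1` for `p ∣ N` (1.8, `IsNewform1.cuspCoeff_of_dvd_level_holds`),
and `Λ_f(1 - s) = a Λ_{f̃}(s)` ((i), `weightOne_functionalEquation_holds`).
[cite: DeligneSerreASENS1974, Thm. 4.6 (a) and its proof, (i)–(iv)] -/
theorem artinConductorNat_eq_of_pair (hf : IsNewform1 f)
    (hρ : IsGaloisRepOfNewform1 f (algebraMap (coeffCharField f) ℂ) {p | p ∣ N} ρ)
    (hFEρ : GaloisRepresentations.ArtinRep.SatisfiesFunctionalEquation ρ.toArtinRep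
      (GaloisRepresentations.FramedArtinRep.toArtinRep (GaloisRepresentations.FramedRep.dual ρ))) :
    GaloisRepresentations.GaloisRep.artinConductorNat ρ.toGaloisRep = N := by
  classical
  have hfin : (Set.range (ρ : absoluteGaloisGroup ℚ → GL (Fin 2) ℂ)).Finite := finite_range_framed ρ
  have hN0 : N ≠ 0 := NeZero.ne N
  -- the conductor `M` and the dual `ρ^∨`
  obtain ⟨M, hMdef⟩ : ∃ M : ℕ, GaloisRepresentations.GaloisRep.artinConductorNat ρ.toGaloisRep = M := ⟨_, rfl⟩
  have hM0 : M ≠ 0 := hMdef ▸ GaloisRepresentations.GaloisRep.artinConductorNat_ne_zero ρ.toGaloisRep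
  obtain ⟨ρd, hρd⟩ : ∃ ρd : GaloisRepresentations.FramedGaloisRep ℚ ℂ 2, GaloisRepresentations.FramedRep.dual ρ = ρd := ⟨_, rfl⟩
  have hfind : (Set.range ρd).Finite := hρd ▸ GaloisRepresentations.FramedRep.finite_range_dual ρ hfin
  have hMd : GaloisRepresentations.GaloisRep.artinConductorNat ρd.toGaloisRep = M := by
    rw [← hρd, ← hMdef]
    exact GaloisRepresentations.FramedGaloisRep.artinConductorNat_dual ρ hfin
  have hoddρ : GaloisRepresentations.FramedGaloisRep.IsOdd ρ := rem45_isOdd_holds hf ρ hρ hfin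
  have hoddd : GaloisRepresentations.FramedGaloisRep.IsOdd ρd := hρd ▸ GaloisRepresentations.FramedGaloisRep.isOdd_dual hoddρ
  have hfinA : (Set.range (GaloisRepresentations.FramedArtinRep.toArtinRep ρ :
      absoluteGaloisGroup ℚ → (Fin 2 → ℂ) →ₗ[ℂ] (Fin 2 → ℂ))).Finite :=
    (GaloisRepresentations.FramedRep.finite_range_toContinuousRep_iff ρ).mpr hfin
  have hfinAd : (Set.range (GaloisRepresentations.FramedArtinRep.toArtinRep ρd :
      absoluteGaloisGroup ℚ → (Fin 2 → ℂ) →ₗ[ℂ] (Fin 2 → ℂ))).Finite :=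
    (GaloisRepresentations.FramedRep.finite_range_toContinuousRep_iff ρd).mpr hfind
  -- roots of the Euler factors (roots of unity)
  choose B hB using fun v =>
    GaloisRepresentations.ArtinRep.exists_eval_eulerFactorAt_eq_prod (GaloisRepresentations.FramedArtinRep.toArtinRep ρ) hfinA v
  choose Bd hBd using fun v =>
    GaloisRepresentations.ArtinRep.exists_eval_eulerFactorAt_eq_prod (GaloisRepresentations.FramedArtinRep.toArtinRep ρd) hfinAd v
  have hB1 : ∀ v, ∀ β ∈ B v, ‖β‖ = 1 := fun v => (hB v).1
  have hBd1 : ∀ v, ∀ β ∈ Bd v, ‖β‖ = 1 := fun v => (hBd v).1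
  have hB2 : ∀ v z, ((GaloisRepresentations.FramedArtinRep.toArtinRep ρ).eulerFactorAt v).eval z =
      ((B v).map fun β => 1 - β * z).prod := fun v => (hB v).2
  have hBd2 : ∀ v z, ((GaloisRepresentations.FramedArtinRep.toArtinRep ρd).eulerFactorAt v).eval z =
      ((Bd v).map fun β => 1 - β * z).prod := fun v => (hBd v).2
  -- the finite Euler data `G`, `H` of Lemma 4.9 on `S = N.primeFactors`
  have hS : ∀ p ∈ N.primeFactors, p.Prime := fun p hp => Nat.prime_of_mem_primeFactors hp
  have hS0 : ∀ p ∈ N.primeFactors, p ≠ 0 := fun p hp => (hS p hp).ne_zero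
  obtain ⟨G, hGdef⟩ : ∃ G : ℕ → LFunctions.EulerFactorData,
      G = fun p => ⟨B (Rat.placeOf p), {cuspCoeff f p}⟩ := ⟨_, rfl⟩
  obtain ⟨H, hHdef⟩ : ∃ H : ℕ → LFunctions.EulerFactorData,
      H = fun p => ⟨Bd (Rat.placeOf p), {(starRingEnd ℂ) (cuspCoeff f p)}⟩ := ⟨_, rfl⟩
  have hnumG : ∀ (p : ℕ) (s : ℂ), (G p).numFun p s = eulerEval ρ p s := fun p s => by
    simp only [LFunctions.EulerFactorData.numFun, hGdef, eulerEval, hB2, LFunctions.eulerTerm]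
  have hnumH : ∀ (p : ℕ) (s : ℂ), (H p).numFun p s = eulerEval ρd p s := fun p s => by
    simp only [LFunctions.EulerFactorData.numFun, hHdef, eulerEval, hBd2, LFunctions.eulerTerm]
  have hdenG : ∀ (p : ℕ) (s : ℂ), (G p).denFun p s = 1 - cuspCoeff f p * (p : ℂ) ^ (-s) :=
    fun p s => by simp [LFunctions.EulerFactorData.denFun, hGdef, LFunctions.eulerTerm]
  have hdenH : ∀ (p : ℕ) (s : ℂ),
      (H p).denFun p s = 1 - (starRingEnd ℂ) (cuspCoeff f p) * (p : ℂ) ^ (-s) :=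
    fun p s => by simp [LFunctions.EulerFactorData.denFun, hHdef, LFunctions.eulerTerm]
  have hNumG : ∀ s, LFunctions.finiteEulerNum N.primeFactors G s = ∏ p ∈ N.primeFactors, eulerEval ρ p s :=
    fun s => Finset.prod_congr rfl fun p _ => hnumG p s
  have hNumH : ∀ s, LFunctions.finiteEulerNum N.primeFactors H s = ∏ p ∈ N.primeFactors, eulerEval ρd p s :=
    fun s => Finset.prod_congr rfl fun p _ => hnumH p s
  have hDenG : ∀ s, LFunctions.finiteEulerDen N.primeFactors G s =
      ∏ p ∈ N.primeFactors, (1 - cuspCoeff f p * (p : ℂ) ^ (-s)) :=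
    fun s => Finset.prod_congr rfl fun p _ => hdenG p s
  have hDenH : ∀ s, LFunctions.finiteEulerDen N.primeFactors H s =
      ∏ p ∈ N.primeFactors, (1 - (starRingEnd ℂ) (cuspCoeff f p) * (p : ℂ) ^ (-s)) :=
    fun s => Finset.prod_congr rfl fun p _ => hdenH p s
  -- the bounds `|β| = 1 < √p`, `|a_p| ≤ 1 < √p` of (iv); 1.8 is `cuspCoeff_of_dvd_level_holds`
  have hap : ∀ p ∈ N.primeFactors, ‖cuspCoeff f p‖ ≤ 1 := fun p hp =>
    IsNewform1.norm_cuspCoeff_le_one_of_dvd_level IsNewform1.cuspCoeff_of_dvd_level_holds hf (hS p hp)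
      (Nat.dvd_of_mem_primeFactors hp)
  have hG : ∀ p ∈ N.primeFactors, ∀ α ∈ (G p).num + (G p).den, ‖α‖ < Real.sqrt p := by
    intro p hp α hα
    have h1 := one_lt_sqrt_of_mem_primeFactors hp
    simp only [hGdef, Multiset.mem_add, Multiset.mem_singleton] at hα
    rcases hα with hα | rfl
    · rw [hB1 _ α hα]; exact h1
    · exact lt_of_le_of_lt (hap p hp) h1
  have hH : ∀ p ∈ N.primeFactors, ∀ α ∈ (H p).num + (H p).den, ‖α‖ < Real.sqrt p := by
    intro p hp α hα
    have h1 := one_lt_sqrt_of_mem_primeFactors hp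
    simp only [hHdef, Multiset.mem_add, Multiset.mem_singleton] at hα
    rcases hα with hα | rfl
    · rw [hBd1 _ α hα]; exact h1
    · rw [Complex.norm_conj]; exact lt_of_le_of_lt (hap p hp) h1
  -- nonvanishing of the bad factors for `re s > 0`
  have hE0 : ∀ {s : ℂ}, 0 < s.re → ∀ p ∈ N.primeFactors, eulerEval ρ p s ≠ 0 := by
    intro s hs p hp
    rw [← hnumG]
    simp only [LFunctions.EulerFactorData.numFun, hGdef]
    refine Multiset.prod_ne_zero fun h0 => ?_
    obtain ⟨β, hβ, hβ0⟩ := Multiset.mem_map.mp h0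
    exact eulerTerm_ne_zero_of_norm_le_one (hS p hp).two_le (hB1 _ β hβ).le hs hβ0
  have hEd0 : ∀ {s : ℂ}, 0 < s.re → ∀ p ∈ N.primeFactors, eulerEval ρd p s ≠ 0 := by
    intro s hs p hp
    rw [← hnumH]
    simp only [LFunctions.EulerFactorData.numFun, hHdef]
    refine Multiset.prod_ne_zero fun h0 => ?_
    obtain ⟨β, hβ, hβ0⟩ := Multiset.mem_map.mp h0
    exact eulerTerm_ne_zero_of_norm_le_one (hS p hp).two_le (hBd1 _ β hβ).le hs hβ0
  have hc0 : ∀ {s : ℂ}, 0 < s.re → ∀ p ∈ N.primeFactors, 1 - cuspCoeff f p * (p : ℂ) ^ (-s) ≠ 0 :=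
    fun {s} hs p hp => eulerTerm_ne_zero_of_norm_le_one (hS p hp).two_le (hap p hp) hs
  have hcc0 : ∀ {s : ℂ}, 0 < s.re → ∀ p ∈ N.primeFactors,
      1 - (starRingEnd ℂ) (cuspCoeff f p) * (p : ℂ) ^ (-s) ≠ 0 := fun {s} hs p hp =>
    eulerTerm_ne_zero_of_norm_le_one (hS p hp).two_le (by rw [Complex.norm_conj]; exact hap p hp) hs
  -- (i) (`weightOne_functionalEquation_holds`) and (ii) (the hypothesis): the functional equations
  obtain ⟨a, ha0, Ef, hEf, Ec, hEc, hfe⟩ := weightOne_functionalEquation_holds hf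
  obtain ⟨Λ, Λ', hΛm, hΛ'm, hagreeΛ, W, hW1, hFEA⟩ := hFEρ
  rw [hρd] at hagreeΛ
  have hW0 : W ≠ 0 := by
    rintro rfl
    simp at hW1
  -- (iii): (B1) and (B2) on `re s > 3/2`
  have hB1' : ∀ s : ℂ, 3 / 2 < s.re → (N : ℂ) ^ (s / 2) * Λ s * LFunctions.finiteEulerNum N.primeFactors G s =
      2 * (M : ℂ) ^ (s / 2) * Ef s * LFunctions.finiteEulerDen N.primeFactors G s := by
    intro s hs
    have hs1 : 1 < s.re := by linarith
    have hs0 : 0 < s.re := by linarith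
    have hs' : ((1 : ℤ) : ℝ) / 2 + 1 < s.re := by push_cast; linarith
    have hA1 := artin_mul_prod_eq (N := N) (c := cuspCoeff f)
      (e := fun p => nebentypus f (p : ZMod N))
      (hasProd_eulerEval ρ hs1) (hasProd_newformEulerEval hf hs)
      (fun p hp hpN => eulerEval_eq_newformEulerEval hρ hp hpN s)
      (fun p hp hpN => Automorphic.dirichletCharacter_apply_eq_zero_of_prime_dvd (nebentypus f) hp hpN)
      (hE0 hs0) (hc0 hs0)
    rw [(hagreeΛ s hs1).1, GaloisRepresentations.FramedArtinRep.completedArtinLFunction_eq_of_isOdd ρ hoddρ s, hMdef,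
      hEf.2 s hs', completedCuspFormL, hNumG, hDenG]
    linear_combination (2 * (M : ℂ) ^ (s / 2) * (N : ℂ) ^ (s / 2) * (2 * Real.pi : ℂ) ^ (-s) *
      Complex.Gamma s) * hA1
  have hB2' : ∀ s : ℂ, 3 / 2 < s.re → (N : ℂ) ^ (s / 2) * Λ' s * LFunctions.finiteEulerNum N.primeFactors H s =
      2 * (M : ℂ) ^ (s / 2) * Ec s * LFunctions.finiteEulerDen N.primeFactors H s := by
    intro s hs
    have hs1 : 1 < s.re := by linarith
    have hs0 : 0 < s.re := by linarith
    have hs' : ((1 : ℤ) : ℝ) / 2 + 1 < s.re := by push_cast; linarith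
    have hA2 := artin_mul_prod_eq (N := N) (c := fun p => (starRingEnd ℂ) (cuspCoeff f p))
      (e := fun p => (starRingEnd ℂ) (nebentypus f (p : ZMod N)))
      (hasProd_eulerEval ρd hs1) (hasProd_conjNewformEulerEval hf hs)
      (fun p hp hpN => by rw [← hρd]; exact eulerEval_dual_eq_conjNewformEulerEval hρ hfin hp hpN s)
      (fun p hp hpN => by
        simp only [Automorphic.dirichletCharacter_apply_eq_zero_of_prime_dvd (nebentypus f) hp hpN, map_zero])
      (hEd0 hs0) (hcc0 hs0)
    rw [(hagreeΛ s hs1).2, GaloisRepresentations.FramedArtinRep.completedArtinLFunction_eq_of_isOdd ρd hoddd s, hMd,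
      hEc.2 s hs', completedConjCuspFormL, hNumH, hDenH]
    linear_combination (2 * (M : ℂ) ^ (s / 2) * (N : ℂ) ^ (s / 2) * (2 * Real.pi : ℂ) ^ (-s) *
      Complex.Gamma s) * hA2
  -- `Λ_{f̃} ≢ 0`
  have hEc0 : ∃ w, Ec w ≠ 0 := by
    obtain ⟨x, hx, hx0⟩ := exists_conjCuspFormLSeries_ne_zero hf
    refine ⟨x, ?_⟩
    have hx' : ((1 : ℤ) : ℝ) / 2 + 1 < (x : ℂ).re := by rw [ofReal_re]; push_cast; linarith
    rw [hEc.2 x hx', completedConjCuspFormL]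
    refine mul_ne_zero (mul_ne_zero (mul_ne_zero ?_ ?_) (Complex.Gamma_ne_zero_of_re_pos ?_)) hx0
    · exact fun h0 => hN0 (Nat.cast_eq_zero.mp ((cpow_eq_zero_iff _ _).mp h0).1)
    · intro h0
      have := ((cpow_eq_zero_iff _ _).mp h0).1
      simp [Real.pi_ne_zero] at this
    · rw [ofReal_re]; linarith
  -- (iii)–(iv): eliminate the L-functions, then Lemma 4.9
  have hX := crossIdentity_of_functionalEquations (cN := (N : ℂ)) (cM := (M : ℂ))
    (Nat.cast_ne_zero.mpr hN0) (Nat.cast_ne_zero.mpr hM0) hΛ'm hEc.1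
    (differentiable_finiteEulerNum hS0 G) (differentiable_finiteEulerDen hS0 G)
    (differentiable_finiteEulerNum hS0 H) (differentiable_finiteEulerDen hS0 H) hB1' hB2' hFEA hfe
    hEc0
  rw [hMdef]
  exact (level_eq_conductor_of_crossIdentity (Nat.pos_of_ne_zero hN0) (Nat.pos_of_ne_zero hM0) hS
    hG hH ha0 hW0 hX).symm

/-- **Deligne–Serre 1974, Thm. 4.6 (a) (with Rem. 4.3) from Artin's functional equation over `ℚ`
alone.**  Input (i) of `thm46a_of_functionalEquations`, the weight-one functional equation
`Λ_f(1 - s) = a Λ_{f̃}(s)` of a newform on `Γ₁(N)`, is the theorem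
`DeligneSerre1974.weightOne_functionalEquation_holds` (`Gamma1NewformLSeriesFrickeProofs`); what
remains of the printed inputs is (ii), `artin_functional_equation (K := ℚ)` (Artin 1931,
Brauer 1947).  Once it is discharged, `thm46a_artinConductorNat_eq_holds` is this theorem applied
to `artin_functional_equation_holds`.  (Equivalently: `artinConductorNat_eq_of_pair` at
`hFEρ ρ`.) [cite: DeligneSerreASENS1974, Thm. 4.6 (a) and its proof, (i)–(iv)] -/
theorem thm46a_of_artin_functional_equation (hFEρ : artin_functional_equation (K := ℚ)) :
    thm46a_artinConductorNat_eq (N := N) :=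
  thm46a_of_functionalEquations weightOne_functionalEquation_holds hFEρ

/-- **Deligne–Serre 1974, Thm. 4.6 (a) (with Rem. 4.3) from the current leaves of Artin's
functional equation** (Neukirch, *Algebraic Number Theory*, VII, proof of (12.6)): Brauer's
factorisation of the completed Artin `L`-functions over `ℚ`
(`brauer_completedArtinLFunction_eq_prod_zpow (K := ℚ)`) and the functional equation for
characters of degree one over every number field (`artin_functional_equation_rankOne`), assembled
by the proved `artin_functional_equation_of_brauer_of_rankOne`
(`Literature.NumberTheory.Automorphic.ArtinLFunctionsFunctionalEquation`).
[cite: DeligneSerreASENS1974, Thm. 4.6 (a)] [cite: NeukirchANT1999, VII (12.6) proof] -/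
theorem thm46a_of_brauer_of_rankOne
    (hA : brauer_completedArtinLFunction_eq_prod_zpow (K := ℚ))
    (hB : ∀ (M : Type) [Field M] [NumberField M], artin_functional_equation_rankOne (K := M)) :
    thm46a_artinConductorNat_eq (N := N) :=
  thm46a_of_artin_functional_equation (artin_functional_equation_of_brauer_of_rankOne hA hB)

end ModularForms.DeligneSerre1974

/-! ### The named fact `artinConductorNat_eq_level` from (ii) alone, and for one pair -/

section Lang

open EllipticCurves.ModularForms EllipticCurves.ModularForms.DeligneSerre1974
  ModularForms.DeligneSerre1974

variable {N : ℕ} [NeZero N] {f : CuspForm (Gamma1 N) 1}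
  {ρ : GaloisRepresentations.FramedArtinRep ℚ 2}

/-- **`artinConductorNat_eq_level` from Artin's functional equation over `ℚ` alone**
(`artinConductorNat_eq_level_of_functionalEquations` with (i) discharged by
`weightOne_functionalEquation_holds`).  Once `artin_functional_equation (K := ℚ)` is discharged,
`artinConductorNat_eq_level_holds` is this theorem applied to its `_holds` version.
[cite: DeligneSerreASENS1974, Thm. 4.6 (a) and Rem. 4.3] -/
theorem artinConductorNat_eq_level_of_artin_functional_equation
    (hFEρ : artin_functional_equation (K := ℚ)) :
    artinConductorNat_eq_level (f := f) (ρ := ρ) :=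
  artinConductorNat_eq_level_of (thm46a_of_artin_functional_equation hFEρ)

/-- **`artinConductorNat_eq_level` for one pair `(f, ρ)` from Artin's functional equation of that
`ρ`** (`artinConductorNat_eq_of_pair`): for a continuous `ρ : Γ_ℚ → GL₂(ℂ)` attached away from
`N` to the weight-one newform `f ∈ S₁(Γ₁(N))` and satisfying `Λ(1 - s, ρ) = W Λ(s, ρ^∨)`,
`𝔣(ρ) = N`. [cite: DeligneSerreASENS1974, Thm. 4.6 (a) and Rem. 4.3] -/
theorem artinConductorNat_eq_level_of_pair
    (hFEρ : GaloisRepresentations.ArtinRep.SatisfiesFunctionalEquation ρ.toArtinRep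
      (GaloisRepresentations.FramedArtinRep.toArtinRep (GaloisRepresentations.FramedRep.dual ρ))) :
    artinConductorNat_eq_level (f := f) (ρ := ρ) :=
  fun hf hρ => artinConductorNat_eq_of_pair hf hρ hFEρ

/-- **`artinConductorNat_eq_level` from the current leaves of Artin's functional equation**
(Brauer's factorisation over `ℚ` and the degree-one case over every number field;
`thm46a_of_brauer_of_rankOne` with `artinConductorNat_eq_level_of`).
[cite: DeligneSerreASENS1974, Thm. 4.6 (a) and Rem. 4.3] [cite: NeukirchANT1999, VII (12.6) proof] -/
theorem artinConductorNat_eq_level_of_brauer_of_rankOne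
    (hA : brauer_completedArtinLFunction_eq_prod_zpow (K := ℚ))
    (hB : ∀ (M : Type) [Field M] [NumberField M], artin_functional_equation_rankOne (K := M)) :
    artinConductorNat_eq_level (f := f) (ρ := ρ) :=
  artinConductorNat_eq_level_of (thm46a_of_brauer_of_rankOne hA hB)

end Lang

end Literature.NumberTheory.Automorphic

end
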